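import Summits.QuantumFields.BalabanUV.Beta.RemainderExplicitLogRate

/-!
# RemainderExplicitHarmonicRenewal — ROAD P3: THE RENEWAL SEQUENCE OF THE STEP LAW `1∕(m(m+1))`
# (def-free: existence, the defining identity `Σ_{a≤n} u_{n−a}∕(a+1) = 1`, `u ≥ 0`, **u antitone**, `u_n·H_{n+1} ≤ 1`,
# `u_n ≤ 1∕log(n+2)`, and the double-sum bound `Σ_{m<K} (Σ_{i≤m} u_i)∕(m+1)² ≤ 2(1 + log(1 + log K))`)

Cell `pub-balaban`, β-function sub-cell, BINDER row D4 «RemainderConst leaves for Bałaban's split» (`HOME/BINDER-OWNERS.md`; owner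
lineage `b2b-balaban-beta-an4`; this file by co-owner #3 lineage `b2b-balaban-beta-d4-p3`, road P3 «the reduction road», generation 41),
β-FLOW TEAM duty (1); FREEZE (0) honoured (def-free module in road P3's own `RemainderExplicit*` series; no leaf, no interface, no
Literature file).  SOURCE OF THE OCCASION: [BalabanJaffe1986] Part III §4 p. 250, (3.73)–(3.76), as SHAPES ONLY (typers' bank
`beta/ERICE-STATEMENT.md` §C) — this file itself is pure real analysis and cites nothing of the source.

THE OCCASION.  Road P3 (generation 40, `RemainderExplicitLinearizationDefectSignedFamily.reprBounded_iff_signedHarmonic`) proved that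
outside the sign-coherent cone the EXACT one-loop letter of the K-uniform linearization of (3.74) is the FULL-SUM SIGNED HARMONIC TRANSFORM
`∃ H ∀ K |Σ_{i<K} (β_{i,0} − β₀)∕(K − i)| ≤ H` of the one-loop errors.  The OWNER's station (D4-J16) (generation 77) showed that the
KERNEL letter N3-ker is then NOT necessary, and — in the stronger currency «bounded errors + the signed kernel functional WITH ALL ITS
PARTIAL SUMS bounded» — that the kernel functional is `O(log log K)` and that this rate is attained; whether road P3's FULL-SUM letter
ALONE forces the iterated logarithm was left «NOT adjudicated».  The companion file `RemainderExplicitSignedLetterIteratedLog` adjudicates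
it (YES); THIS file supplies the engine: the partial sums `D_K = Σ_{i<K} δ_i` of ANY real sequence solve a discrete RENEWAL EQUATION
`D_K = Σ_{m=1}^{K} D_{K−m}∕(m(m+1)) + h(K)` driven by the signed harmonic transform `h(K) = Σ_{i<K} δ_i∕(K − i)`, whence
`D_K = Σ_{s<K} u_{K−1−s}·h(s+1)` with `u` the RENEWAL SEQUENCE of the step law `p_m = 1∕(m(m+1))` (a law on `m ≥ 1` with
`Σ_{m>j} p_m = 1∕(j+1)`, infinite mean).  Everything the companion needs about `u` is proved here, WITHOUT a `def`: `u` enters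
every theorem as a variable carrying the defining identity (R) `∀ n, Σ_{a≤n} u_{n−a}∕(a+1) = 1` (the renewal equation against the tail
`1∕(j+1)` of the step law), and §1 proves that such a `u` EXISTS (strong recursion).

WHAT THIS FILE PROVES ([folklore] discrete renewal theory, elementary; 0 sorry, 0 `def`).
* §1 `renewal_exists` (∃ u, (R)); `renewal_zero` (`u_0 = 1`); `renewal_step` (the step-law form `u_{n+1} = Σ_{a≤n} u_{n−a}∕((a+1)(a+2))`);
  `renewal_nonneg`.
* §2 **`renewal_diff`** — THE DIFFERENCE IDENTITY `Σ_{a≤n} (u_{n−a} − u_{n+1−a})∕(a+1) = 1∕(n+2)` ((R) at n+1 minus (R) at n); and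
  **`renewal_succ_le` ∕ `renewal_antitone`: u IS NON-INCREASING** — by strong induction on the difference identity: the earlier
  differences are ≥ 0, their weights satisfy `1∕(a+2) ≤ ((n+1)∕(n+2))·1∕(a+1)` for `a ≤ n`, so
  `u_{n+1} − u_{n+2} ≥ 1∕(n+3) − (n+1)∕(n+2)² > 0`.  (The differences `u_{n−1} − u_n` are the moduli of the GREGORY coefficients —
  `1∕2, 1∕12, 1∕24, 19∕720, …` — whose positivity is classical via `∫₀¹ x(1−x)(2−x)⋯(n−1−x) dx∕n!`; the induction here needs no integral
  and no generating function.)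
* §3 `renewal_le_one`; **`renewal_mul_harmonic_le`** (`u_n·H_{n+1} ≤ 1`, `H_{n+1} = Σ_{a≤n} 1∕(a+1)` — u antitone inside (R)); hence
  `renewal_le_inv_log` (`u_n ≤ 1∕log(n+2)`, Mathlib's `log_add_one_le_harmonic`): the renewal sequence decays like `1∕log n`
  (Erickson's null-recurrent renewal theorem for index 1, upper half, with constant 1).
* §4 harmonic–log bookkeeping: `inv_mul_harmonic_le_log_sub` (`1∕((i+1)H_{i+1}) ≤ log H_{i+1} − log H_i`, i ≥ 1);
  **`sum_renewal_div_succ_le`** (`Σ_{i<K} u_i∕(i+1) ≤ 1 + log(1 + log K)`); `sum_Ico_inv_sq_succ_le` (`Σ_{i≤m<K} 1∕(m+1)² ≤ 2∕(i+1)`);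
  END **`sum_partialRenewal_div_sq_le`**: `Σ_{m<K} (Σ_{i≤m} u_i)∕(m+1)² ≤ 2·(1 + log(1 + log K))` — the iterated logarithm.
HONEST FRAMING (BETA-SPEC §0.2, verbatim and binding). *"Discharging BetaPertH makes Bałaban's UV stability UNCONDITIONAL — a real
constructive-QFT result; it is NOT the continuum limit and NOT the Clay problem."*  THIS MODULE DISCHARGES NOTHING: elementary real analysis
with no β-function object in any statement; nothing of Bałaban's (1.22) or of Bałaban–Jaffe's β_n is asserted, constructed or instantiated;
row D4 class UNCHANGED (critical-path width 0: THE INSTANCE over NODE O.2 absent; instance 0∕1; D4 DISCHARGE NO DATE).  NOT [Balaban1987RG1]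
Theorem 2, NOT BetaPertH, NOT continuum, NOT Clay.  HONEST DEPENDENCY: continuum YM on T⁴ ⇐ BetaPertH ∧ nine spine estimates (0/9 proved);
BetaPertH ⇐ (D1) ∧ (D4) ∧ CAP+tail; G-an2-4 gates asym, D1 and NE2/3/4.
-/

noncomputable section

open Finset Real

namespace Summit.QuantumFields.BalabanUV.Beta.RemainderExplicitHarmonicRenewal

open Summit.QuantumFields.BalabanUV.Beta.RemainderExplicitLogRate (sum_range_inv_succ_eq_harmonic)

/-! ## §1 Existence, the value at 0, the step-law form, nonnegativity -/

/-- **EXISTENCE OF THE RENEWAL SEQUENCE** (def-free): there is `u : ℕ → ℝ` with `Σ_{a≤n} u_{n−a}∕(a+1) = 1` for every n — strong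
recursion `u_n = 1 − Σ_{a<n} u_{n−1−a}∕(a+2)`. [folklore] -/
theorem renewal_exists : ∃ u : ℕ → ℝ, ∀ n : ℕ, ∑ a ∈ range (n + 1), u (n - a) / ((a : ℝ) + 1) = 1 := by
  let ind : ∀ n : ℕ, (∀ m : ℕ, m < n → ℝ) → ℝ := fun n ih =>
    1 - ∑ a ∈ range n, (if h : a < n then ih (n - 1 - a) (by omega) else 0) / ((a : ℝ) + 2)
  refine ⟨fun t => Nat.strongRec ind t, fun n => ?_⟩
  simp only []
  have key : Nat.strongRec ind n = 1 - ∑ a ∈ range n, Nat.strongRec ind (n - 1 - a) / ((a : ℝ) + 2) := by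
    rw [Nat.strongRec_eq]
    show 1 - ∑ a ∈ range n, (if h : a < n then Nat.strongRec ind (n - 1 - a) else 0) / ((a : ℝ) + 2) = _
    congr 1
    refine sum_congr rfl fun a ha => ?_
    rw [dif_pos (mem_range.mp ha)]
  rw [sum_range_succ', Nat.sub_zero, Nat.cast_zero, zero_add, div_one, key]
  have e : ∀ a ∈ range n, Nat.strongRec ind (n - (a + 1)) / (((a + 1 : ℕ) : ℝ) + 1) =
      Nat.strongRec ind (n - 1 - a) / ((a : ℝ) + 2) := by
    intro a _
    rw [show n - (a + 1) = n - 1 - a by omega]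
    push_cast
    ring
  rw [sum_congr rfl e]
  ring

variable {u : ℕ → ℝ}

/-- `u_0 = 1` ((R) at n = 0). -/
theorem renewal_zero (hu : ∀ n : ℕ, ∑ a ∈ range (n + 1), u (n - a) / ((a : ℝ) + 1) = 1) : u 0 = 1 := by
  simpa using hu 0

/-- **THE STEP-LAW FORM** ((R) at n+1 minus (R) at n): `u_{n+1} = Σ_{a≤n} u_{n−a}∕((a+1)(a+2))` — the renewal sequence of the law
`p_m = 1∕(m(m+1))` on `m ≥ 1`. [folklore] -/
theorem renewal_step (hu : ∀ n : ℕ, ∑ a ∈ range (n + 1), u (n - a) / ((a : ℝ) + 1) = 1) (n : ℕ) :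
    u (n + 1) = ∑ a ∈ range (n + 1), u (n - a) / (((a : ℝ) + 1) * ((a : ℝ) + 2)) := by
  have h1 := hu (n + 1)
  have h0 := hu n
  rw [sum_range_succ'] at h1
  have e : ∀ a ∈ range (n + 1), u (n + 1 - (a + 1)) / (((a + 1 : ℕ) : ℝ) + 1) = u (n - a) / ((a : ℝ) + 2) := by
    intro a _
    rw [Nat.add_sub_add_right]
    push_cast
    ring
  rw [sum_congr rfl e] at h1
  simp only [Nat.sub_zero, Nat.cast_zero, zero_add, div_one] at h1
  have h2 : u (n + 1) = ∑ a ∈ range (n + 1), u (n - a) / ((a : ℝ) + 1) -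
      ∑ a ∈ range (n + 1), u (n - a) / ((a : ℝ) + 2) := by linarith
  rw [h2, ← sum_sub_distrib]
  refine sum_congr rfl fun a _ => ?_
  have ha1 : (0 : ℝ) < (a : ℝ) + 1 := by positivity
  have ha2 : (0 : ℝ) < (a : ℝ) + 2 := by positivity
  field_simp
  ring

/-- `u_n ≥ 0` (strong induction on the step-law form). -/
theorem renewal_nonneg (hu : ∀ n : ℕ, ∑ a ∈ range (n + 1), u (n - a) / ((a : ℝ) + 1) = 1) : ∀ n : ℕ, 0 ≤ u n := by
  intro n
  induction n using Nat.strong_induction_on with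
  | _ n ih =>
    rcases n with _ | n
    · rw [renewal_zero hu]; norm_num
    · rw [renewal_step hu n]
      exact sum_nonneg fun a ha => div_nonneg (ih _ (by have := mem_range.mp ha; omega)) (by positivity)

/-! ## §2 The difference identity and monotonicity -/

/-- **THE DIFFERENCE IDENTITY** ((R) at n+1, with its last term `u_0∕(n+2)` split off, minus (R) at n):
`Σ_{a≤n} (u_{n−a} − u_{n+1−a})∕(a+1) = 1∕(n+2)`. [folklore] -/
theorem renewal_diff (hu : ∀ n : ℕ, ∑ a ∈ range (n + 1), u (n - a) / ((a : ℝ) + 1) = 1) (n : ℕ) :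
    ∑ a ∈ range (n + 1), (u (n - a) - u (n + 1 - a)) / ((a : ℝ) + 1) = 1 / ((n : ℝ) + 2) := by
  have h1 := hu (n + 1)
  have h0 := hu n
  rw [sum_range_succ, Nat.sub_self, renewal_zero hu] at h1
  push_cast at h1
  simp only [sub_div, sum_sub_distrib, h0]
  have h2 : ∑ a ∈ range (n + 1), u (n + 1 - a) / ((a : ℝ) + 1) = 1 - 1 / ((n : ℝ) + 1 + 1) := by linarith
  rw [h2]
  ring

/-- **THE RENEWAL SEQUENCE IS NON-INCREASING**: `u_{n+1} ≤ u_n` — strong induction on the difference identity (positivity of the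
Gregory moduli without computing them): the earlier differences are nonnegative and carry the weights `1∕(a+2) ≤ ((n+1)∕(n+2))·1∕(a+1)`,
so `u_{n+1} − u_{n+2} ≥ 1∕(n+3) − (n+1)∕(n+2)² > 0`. [folklore] -/
theorem renewal_succ_le (hu : ∀ n : ℕ, ∑ a ∈ range (n + 1), u (n - a) / ((a : ℝ) + 1) = 1) : ∀ n : ℕ, u (n + 1) ≤ u n := by
  intro n
  induction n using Nat.strong_induction_on with
  | _ n ih =>
    have hd := renewal_diff hu n
    rw [sum_range_succ'] at hd
    simp only [Nat.sub_zero, Nat.cast_zero, zero_add, div_one] at hd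
    rcases n with _ | k
    · simp only [range_zero, sum_empty, zero_add] at hd
      norm_num at hd
      linarith
    · have hv : ∀ a ∈ range (k + 1), 0 ≤ u (k - a) - u (k + 1 - a) := by
        intro a ha
        have ha' := mem_range.mp ha
        rw [show k + 1 - a = (k - a) + 1 by omega]
        linarith [ih (k - a) (by omega)]
      have e : ∀ a ∈ range (k + 1), (u (k + 1 - (a + 1)) - u (k + 1 + 1 - (a + 1))) / (((a + 1 : ℕ) : ℝ) + 1) =
          (u (k - a) - u (k + 1 - a)) / ((a : ℝ) + 2) := by
        intro a _
        rw [Nat.add_sub_add_right, Nat.add_sub_add_right]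
        push_cast
        ring
      rw [sum_congr rfl e] at hd
      have hcmp : ∑ a ∈ range (k + 1), (u (k - a) - u (k + 1 - a)) / ((a : ℝ) + 2) ≤
          ((k : ℝ) + 1) / ((k : ℝ) + 2) * ∑ a ∈ range (k + 1), (u (k - a) - u (k + 1 - a)) / ((a : ℝ) + 1) := by
        rw [mul_sum]
        refine sum_le_sum fun a ha => ?_
        have ha' : (a : ℝ) ≤ k := by exact_mod_cast Nat.le_of_lt_succ (mem_range.mp ha)
        have hw : 1 / ((a : ℝ) + 2) ≤ ((k : ℝ) + 1) / ((k : ℝ) + 2) * (1 / ((a : ℝ) + 1)) := by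
          rw [div_mul_div_comm, mul_one, div_le_div_iff₀ (by positivity) (by positivity)]
          nlinarith
        calc (u (k - a) - u (k + 1 - a)) / ((a : ℝ) + 2) = (u (k - a) - u (k + 1 - a)) * (1 / ((a : ℝ) + 2)) := by ring
          _ ≤ (u (k - a) - u (k + 1 - a)) * (((k : ℝ) + 1) / ((k : ℝ) + 2) * (1 / ((a : ℝ) + 1))) :=
              mul_le_mul_of_nonneg_left hw (hv a ha)
          _ = _ := by ring
      rw [renewal_diff hu k] at hcmp
      have hnum : ((k : ℝ) + 1) / ((k : ℝ) + 2) * (1 / ((k : ℝ) + 2)) < 1 / (((k + 1 : ℕ) : ℝ) + 2) := by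
        push_cast
        rw [div_mul_div_comm, mul_one, div_lt_div_iff₀ (by positivity) (by positivity)]
        nlinarith
      linarith

/-- `u` is antitone. -/
theorem renewal_antitone (hu : ∀ n : ℕ, ∑ a ∈ range (n + 1), u (n - a) / ((a : ℝ) + 1) = 1) : Antitone u :=
  antitone_nat_of_succ_le (renewal_succ_le hu)

/-! ## §3 Bounds: `u ≤ 1`, `u_n·H_{n+1} ≤ 1`, `u_n ≤ 1∕log(n+2)` -/

/-- `u_n ≤ 1`. -/
theorem renewal_le_one (hu : ∀ n : ℕ, ∑ a ∈ range (n + 1), u (n - a) / ((a : ℝ) + 1) = 1) (n : ℕ) : u n ≤ 1 :=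
  (renewal_antitone hu (Nat.zero_le n)).trans (renewal_zero hu).le

/-- **`u_n·H_{n+1} ≤ 1`** with `H_{n+1} = Σ_{a≤n} 1∕(a+1)`: u is antitone inside the defining identity (R). [folklore] -/
theorem renewal_mul_harmonic_le (hu : ∀ n : ℕ, ∑ a ∈ range (n + 1), u (n - a) / ((a : ℝ) + 1) = 1) (n : ℕ) :
    u n * ∑ a ∈ range (n + 1), 1 / ((a : ℝ) + 1) ≤ 1 := by
  calc u n * ∑ a ∈ range (n + 1), 1 / ((a : ℝ) + 1) = ∑ a ∈ range (n + 1), u n / ((a : ℝ) + 1) := by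
        rw [mul_sum]
        exact sum_congr rfl fun a _ => by ring
    _ ≤ ∑ a ∈ range (n + 1), u (n - a) / ((a : ℝ) + 1) :=
        sum_le_sum fun a _ => div_le_div_of_nonneg_right (renewal_antitone hu (Nat.sub_le n a)) (by positivity)
    _ = 1 := hu n

/-- **`u_n ≤ 1∕log(n+2)`** (Mathlib's `log_add_one_le_harmonic` and road P3's cast bookkeeping `sum_range_inv_succ_eq_harmonic`). -/
theorem renewal_le_inv_log (hu : ∀ n : ℕ, ∑ a ∈ range (n + 1), u (n - a) / ((a : ℝ) + 1) = 1) (n : ℕ) :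
    u n ≤ 1 / Real.log ((n : ℝ) + 2) := by
  have hH : Real.log ((n : ℝ) + 2) ≤ ∑ a ∈ range (n + 1), 1 / ((a : ℝ) + 1) := by
    rw [sum_range_inv_succ_eq_harmonic]
    have h := log_add_one_le_harmonic (n + 1)
    push_cast at h
    rw [show (n : ℝ) + 1 + 1 = (n : ℝ) + 2 by ring] at h
    exact h
  have hlog : 0 < Real.log ((n : ℝ) + 2) := Real.log_pos (by have : (0 : ℝ) ≤ n := n.cast_nonneg; linarith)
  rw [le_div_iff₀ hlog]
  calc u n * Real.log ((n : ℝ) + 2) ≤ u n * ∑ a ∈ range (n + 1), 1 / ((a : ℝ) + 1) :=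
        mul_le_mul_of_nonneg_left hH (renewal_nonneg hu n)
    _ ≤ 1 := renewal_mul_harmonic_le hu n

/-! ## §4 Harmonic–log bookkeeping and the double-sum bound (the iterated logarithm) -/

/-- `1∕((i+1)·H_{i+1}) ≤ log H_{i+1} − log H_i` for `i ≥ 1` (`H_n = Σ_{a<n} 1∕(a+1)`; `1 − x⁻¹ ≤ log x` at `x = H_{i+1}∕H_i`).
[folklore] -/
theorem inv_mul_harmonic_le_log_sub {i : ℕ} (hi : 1 ≤ i) :
    1 / (((i : ℝ) + 1) * ∑ a ∈ range (i + 1), 1 / ((a : ℝ) + 1)) ≤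
      Real.log (∑ a ∈ range (i + 1), 1 / ((a : ℝ) + 1)) - Real.log (∑ a ∈ range i, 1 / ((a : ℝ) + 1)) := by
  set Hi := ∑ a ∈ range i, 1 / ((a : ℝ) + 1) with hHi
  have hsucc : ∑ a ∈ range (i + 1), 1 / ((a : ℝ) + 1) = Hi + 1 / ((i : ℝ) + 1) := by rw [sum_range_succ]
  have hHi_pos : 0 < Hi := by
    have h1 : ∑ a ∈ range 1, 1 / ((a : ℝ) + 1) ≤ Hi :=
      sum_le_sum_of_subset_of_nonneg (range_mono hi) fun _ _ _ => by positivity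
    simp at h1
    linarith
  have hH1_pos : 0 < Hi + 1 / ((i : ℝ) + 1) := by positivity
  rw [hsucc, ← Real.log_div hH1_pos.ne' hHi_pos.ne']
  have key := Real.one_sub_inv_le_log_of_pos (div_pos hH1_pos hHi_pos)
  rw [inv_div] at key
  have e : 1 / (((i : ℝ) + 1) * (Hi + 1 / ((i : ℝ) + 1))) = 1 - Hi / (Hi + 1 / ((i : ℝ) + 1)) := by
    field_simp
    ring
  rw [e]
  exact key

/-- **`Σ_{i<K} u_i∕(i+1) ≤ 1 + log(1 + log K)`**: the term `i = 0` is `1`; for `i ≥ 1`, `u_i∕(i+1) ≤ 1∕((i+1)H_{i+1}) ≤ log H_{i+1} − log H_i`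
telescopes to `log H_K ≤ log(1 + log K)` (Mathlib's `harmonic_le_one_add_log`). [folklore] -/
theorem sum_renewal_div_succ_le (hu : ∀ n : ℕ, ∑ a ∈ range (n + 1), u (n - a) / ((a : ℝ) + 1) = 1) (K : ℕ) :
    ∑ i ∈ range K, u i / ((i : ℝ) + 1) ≤ 1 + Real.log (1 + Real.log K) := by
  rcases K with _ | K
  · simp
  · rw [sum_range_succ']
    simp only [Nat.cast_zero, zero_add, div_one, renewal_zero hu]
    have hterm : ∀ i ∈ range K, u (i + 1) / (((i + 1 : ℕ) : ℝ) + 1) ≤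
        Real.log (∑ a ∈ range (i + 1 + 1), 1 / ((a : ℝ) + 1)) - Real.log (∑ a ∈ range (i + 1), 1 / ((a : ℝ) + 1)) := by
      intro i _
      have h1 := renewal_mul_harmonic_le hu (i + 1)
      have h2 := inv_mul_harmonic_le_log_sub (i := i + 1) (by omega)
      have hH : 0 < ∑ a ∈ range (i + 1 + 1), 1 / ((a : ℝ) + 1) := sum_pos (fun _ _ => by positivity) ⟨0, by simp⟩
      refine le_trans ?_ h2
      rw [div_le_div_iff₀ (by positivity) (by positivity), one_mul]
      calc u (i + 1) * ((((i + 1 : ℕ) : ℝ) + 1) * ∑ a ∈ range (i + 1 + 1), 1 / ((a : ℝ) + 1)) =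
          (u (i + 1) * ∑ a ∈ range (i + 1 + 1), 1 / ((a : ℝ) + 1)) * (((i + 1 : ℕ) : ℝ) + 1) := by ring
        _ ≤ 1 * (((i + 1 : ℕ) : ℝ) + 1) := mul_le_mul_of_nonneg_right h1 (by positivity)
        _ = _ := by ring
    have hpos : 0 < ∑ a ∈ range (K + 1), 1 / ((a : ℝ) + 1) := sum_pos (fun _ _ => by positivity) ⟨0, by simp⟩
    have hHK : ∑ a ∈ range (K + 1), 1 / ((a : ℝ) + 1) ≤ 1 + Real.log ((K + 1 : ℕ) : ℝ) := by
      rw [sum_range_inv_succ_eq_harmonic]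
      exact harmonic_le_one_add_log (K + 1)
    have hlog := Real.log_le_log hpos hHK
    calc ∑ i ∈ range K, u (i + 1) / (((i + 1 : ℕ) : ℝ) + 1) + 1 ≤
        ∑ i ∈ range K, (Real.log (∑ a ∈ range (i + 1 + 1), 1 / ((a : ℝ) + 1)) -
          Real.log (∑ a ∈ range (i + 1), 1 / ((a : ℝ) + 1))) + 1 := by
          gcongr with i hi
          exact hterm i hi
      _ = Real.log (∑ a ∈ range (K + 1), 1 / ((a : ℝ) + 1)) + 1 := by
          rw [sum_range_sub (fun i => Real.log (∑ a ∈ range (i + 1), 1 / ((a : ℝ) + 1))) K]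
          simp
      _ ≤ 1 + Real.log (1 + Real.log ((K + 1 : ℕ) : ℝ)) := by linarith

/-- The tail of `Σ 1∕m²` from `i+1`: `Σ_{i≤m<K} 1∕(m+1)² ≤ 2∕(i+1)` (`1∕(m+1)² ≤ 2∕((m+1)(m+2))`, telescoping). [folklore] -/
theorem sum_Ico_inv_sq_succ_le (i K : ℕ) : ∑ m ∈ Ico i K, 1 / ((m : ℝ) + 1) ^ 2 ≤ 2 / ((i : ℝ) + 1) := by
  rw [sum_Ico_eq_sum_range]
  calc ∑ t ∈ range (K - i), 1 / (((i + t : ℕ) : ℝ) + 1) ^ 2 ≤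
      ∑ t ∈ range (K - i), (2 / ((i : ℝ) + t + 1) - 2 / ((i : ℝ) + (t + 1 : ℕ) + 1)) := by
        refine sum_le_sum fun t _ => ?_
        push_cast
        rw [div_sub_div _ _ (by positivity) (by positivity), div_le_div_iff₀ (by positivity) (by positivity)]
        have : (0 : ℝ) ≤ (i : ℝ) + t := by positivity
        nlinarith
    _ = 2 / ((i : ℝ) + (0 : ℕ) + 1) - 2 / ((i : ℝ) + (K - i : ℕ) + 1) :=
        sum_range_sub' (fun t : ℕ => 2 / ((i : ℝ) + (t : ℕ) + 1)) (K - i)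
    _ ≤ 2 / ((i : ℝ) + 1) := by
        have : 0 ≤ 2 / ((i : ℝ) + (K - i : ℕ) + 1) := by positivity
        rw [Nat.cast_zero, add_zero]
        linarith

/-- **THE ITERATED LOGARITHM** (END of this file): `Σ_{m<K} (Σ_{i≤m} u_i)∕(m+1)² ≤ 2·(1 + log(1 + log K))` — swap the double sum into
`Σ_{i<K} u_i·Σ_{i≤m<K} 1∕(m+1)² ≤ 2Σ_{i<K} u_i∕(i+1)` and apply `sum_renewal_div_succ_le`. [folklore] -/
theorem sum_partialRenewal_div_sq_le (hu : ∀ n : ℕ, ∑ a ∈ range (n + 1), u (n - a) / ((a : ℝ) + 1) = 1) (K : ℕ) :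
    ∑ m ∈ range K, (∑ i ∈ range (m + 1), u i) / ((m : ℝ) + 1) ^ 2 ≤ 2 * (1 + Real.log (1 + Real.log K)) := by
  have hswap : ∑ m ∈ range K, (∑ i ∈ range (m + 1), u i) / ((m : ℝ) + 1) ^ 2 =
      ∑ i ∈ range K, u i * ∑ m ∈ Ico i K, 1 / ((m : ℝ) + 1) ^ 2 := by
    have hcomm := sum_comm' (s := range K) (t := fun m => range (m + 1)) (t' := range K) (s' := fun i => Ico i K)
      (f := fun m i => u i / ((m : ℝ) + 1) ^ 2)
      (fun m i => by
        simp only [mem_range, mem_Ico]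
        constructor
        · rintro ⟨h1, h2⟩; exact ⟨⟨by omega, h1⟩, by omega⟩
        · rintro ⟨⟨h1, h2⟩, h3⟩; exact ⟨h2, by omega⟩)
    simp_rw [sum_div]
    rw [hcomm]
    refine sum_congr rfl fun i _ => ?_
    rw [mul_sum]
    exact sum_congr rfl fun m _ => by ring
  rw [hswap]
  calc ∑ i ∈ range K, u i * ∑ m ∈ Ico i K, 1 / ((m : ℝ) + 1) ^ 2 ≤ ∑ i ∈ range K, u i * (2 / ((i : ℝ) + 1)) :=
        sum_le_sum fun i _ => mul_le_mul_of_nonneg_left (sum_Ico_inv_sq_succ_le i K) (renewal_nonneg hu i)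
    _ = 2 * ∑ i ∈ range K, u i / ((i : ℝ) + 1) := by
        rw [mul_sum]
        exact sum_congr rfl fun i _ => by ring
    _ ≤ 2 * (1 + Real.log (1 + Real.log K)) := by
        have := sum_renewal_div_succ_le hu K
        linarith

end Summit.QuantumFields.BalabanUV.Beta.RemainderExplicitHarmonicRenewal

end
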